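import Summits.Ventures.LatticeQCDFlow.Exactness.SplittingIntegrator
import Summits.Ventures.LatticeQCDFlow.Scoring.FreeFieldLeapfrog
import Mathlib.Analysis.SpecialFunctions.Gaussian.GaussianIntegral
import HarnessLib

/-!
# Leapfrog WITHOUT the accept/reject step samples the shadow Gaussian exactly: the missing Metropolis test costs `δ²/4` of variance in every mode

HONEST FRAMING: exact (Metropolis-corrected) sampling algorithms for lattice gauge theory;
figures of merit are autocorrelation/cost numbers at stated couplings and volumes; no
continuum-physics claim.  (SCALAR calibration rung S0-A: not a gauge result.)

Venture `LatticeQCDFlow` (cell pub-lqcd), sub-topic `Scoring`; FANOUT row 2 (`s0-phi4`: the HMC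
arm of the 2D φ⁴ calibration and the exactness battery, whose acceptance clause is that planted
INVALID kernels — accept/reject removed, Jacobian dropped — FAIL while exact kernels PASS).  NEW
WORK of the cell over Mathlib; nothing is cited as a fact.  Printed counterparts, named only: the
modified-equation / shadow-Hamiltonian analysis of Störmer–Verlet for quadratic Hamiltonians
(Leimkuhler–Reich 2004 ch. 5; Hairer–Lubich–Wanner ch. IX), and the bias of uncorrected
("unadjusted") HMC (Neal 2011 §5.3; Bou-Rabee–Sanz-Serna 2018 §5).

`Scoring/FreeFieldLeapfrog.lean` (row 2) proved that at `λ = 0` the engine's leapfrog decouples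
EXACTLY into the 2 × 2 mode maps `lfMode δ Ω²` (`leapfrog_iterate_mode`), each conserving the
shadow energy `H̃ = ½(Ω²O² + (1 − δ²Ω²/4)P²)` (`lfMode_iterate_shadow`).  `Exactness/Phi4HMCExact.lean`
proved that WITH the Metropolis test the HMC update is exact.  This file types what the planted
control "HMC with the accept/reject REMOVED" does at `λ = 0` — it is an EXACT sampler of the WRONG
Gaussian, with a closed-form error:

## What is proved (one mode: phase space `ℝ × ℝ`, Lebesgue measure, frequency `Ω² = w2`)

* §1 `lfMode_eq_leapfrog` — the mode map IS row 9's `leapfrog` permutation (flat half drifts,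
  harmonic kick), hence `measurePreserving_lfMode[_iterate]`: it preserves Lebesgue measure on
  `ℝ × ℝ` (and is measurable) for every `δ`, `Ω²`, `N`.
* §2 `shadowVariance δ Ω² = 1/Ω² − δ²/4` (`= (1 − δ²Ω²/4)/Ω²`, positive in the stable regime
  `δ²Ω² < 4`, and `< 1/Ω²` = the exact mode variance of `e^{−H}`, `H = ½(Ω²O² + P²)`, whenever
  `δ ≠ 0`); the shadow Gaussian weight `e^{−O²/(2v)} e^{−P²/2}` with `v = shadowVariance` is
  `e^{−(O² + vP²)/(2v)}`, and `O² + v P² = (2/Ω²) H̃` is conserved: **`shadowGauss_lfMode_iterate`**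
  — the weight is invariant under every number of leapfrog steps.
* §3 `unadjLeapfrogOp δ Ω² N f O = (∫ f((M^N(O,P)).1) e^{−P²/2} dP) / ∫ e^{−P²/2} dP` — ONE UPDATE
  OF UNADJUSTED HMC seen by the mode: refresh `P ∼ N(0,1)` (the projection `b·p` of the engine's
  `N(0,1)^Λ` refresh on a unit eigenmode `b`), run `N` steps, KEEP the result (no test);
  **`unadjusted_leapfrog_invariant`** — in the stable regime, for every `N` and every measurable
  `f` with `f e^{−O²/(2v)}` integrable:
  `∫ (U f)(O) e^{−O²/(2v)} dO = ∫ f(O) e^{−O²/(2v)} dO` — the law `N(0, 1/Ω² − δ²/4)` is invariant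
  (Fubini, weight invariance, Liouville, Fubini).  The chain with the accept step instead leaves
  `N(0, 1/Ω²)` invariant (`Exactness/Phi4HMCExact.lean`): removing the test shifts the invariant
  variance of EVERY mode by EXACTLY `−δ²/4`, uniformly in `Ω²`, `N`, `m²`, `L`.
* §4 (rotation form, `θ = arccos(1 − δ²Ω²/2)`, `β = δ(1 − δ²Ω²/4)/sin θ` as in
  `lfMode_iterate_rotation`): `rotation_beta_sq` — `β² = v`; `shadowVariance_fixedPoint` —
  `cos²(Nθ) v + β² sin²(Nθ) = v` (the AR(1) variance map `x ↦ cos²(Nθ) x + β² sin²(Nθ)` of the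
  update `O' = cos(Nθ) O + β sin(Nθ) P` fixes `v`); `exactVariance_step` —
  `cos²(Nθ)/Ω² + β² sin²(Nθ) = 1/Ω² − sin²(Nθ)·δ²/4`: started from the EXACT law, one unadjusted
  update already lowers the mode variance by `sin²(Nθ) δ²/4`.

Reading for the battery (calibration of a planted-INVALID HMC control, numbers not adjectives):
with `V` orthonormal modes the volume-averaged `⟨φ²⟩ = V⁻¹ Σ_k ⟨O_k²⟩` of the unadjusted chain's
invariant law is `⟨φ²⟩_exact − δ²/4` EXACTLY (every mode contributes the same `−δ²/4`).  At the
battery's T1 point (`λ = 0`, `m² = 1`, `L = 6`, `τ = 1`, `n_md = 10`, so `δ = 0.1`; production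
j126384): `Δ⟨φ²⟩ = −2.5·10⁻³` against `⟨φ²⟩_exact = 0.1275` and a Γ-error of `4.3·10⁻⁴` on the
stored statistics — a `5.8σ` must-fail, while `χ₂ = 1/(2m²) = 0.5` moves by the same absolute
`−2.5·10⁻³` (`1.1σ` at its error `2.2·10⁻³`): the UV-summed column, not the susceptibility, is the
detector.  NOT CLAIMED: uniqueness of the
invariant law / convergence of the unadjusted chain (modes with `sin(Nθ) = 0` do not mix), the
lattice-level Gaussian statement (it is the product over modes by `leapfrog_iterate_mode`, not
typed here), anything at `λ > 0`.
-/

namespace Summit.Ventures.LatticeQCDFlow.Scoring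

open Real MeasureTheory Filter
open Summit.Ventures.LatticeQCDFlow.Exactness

/-! ## §1 The mode map is a leapfrog permutation: Liouville on `ℝ × ℝ` -/

section Liouville

/-- **The 2 × 2 mode map is row 9's `leapfrog`** with flat half drifts `O ↦ O + (δ/2)P` and the
harmonic kick `P ↦ P − δΩ²O`. -/
theorem lfMode_eq_leapfrog (δ w2 : ℝ) :
    lfMode δ w2
      = ⇑(leapfrog (addDrift (DistribSMul.toAddMonoidHom ℝ (δ / 2)))
          (fun O : ℝ => -(δ * w2 * O))) := by
  funext z
  rw [leapfrog, Equiv.Perm.coe_mul, Equiv.Perm.coe_mul, Function.comp_apply, Function.comp_apply]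
  show lfMode δ w2 z
      = ((z.1 + (δ / 2) • z.2) + (δ / 2) • (z.2 + -(δ * w2 * (z.1 + (δ / 2) • z.2))),
          z.2 + -(δ * w2 * (z.1 + (δ / 2) • z.2)))
  simp only [lfMode, smul_eq_mul, Prod.mk.injEq]
  constructor <;> ring

/-- The mode map is measurable (it is linear). -/
theorem measurable_lfMode (δ w2 : ℝ) : Measurable (lfMode δ w2) := by
  unfold lfMode
  fun_prop

/-- **Liouville for the mode map**: it preserves Lebesgue measure on `ℝ × ℝ`, for every `δ`, `Ω²`. -/
theorem measurePreserving_lfMode (δ w2 : ℝ) :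
    MeasurePreserving (lfMode δ w2) ((volume : Measure ℝ).prod volume)
      ((volume : Measure ℝ).prod volume) := by
  rw [lfMode_eq_leapfrog]
  have hτ : Measurable (DistribSMul.toAddMonoidHom ℝ (δ / 2) : ℝ →+ ℝ) := by
    change Measurable fun p : ℝ => (δ / 2) • p
    exact measurable_id.const_smul (δ / 2)
  have hg : Measurable fun O : ℝ => -(δ * w2 * O) := by fun_prop
  exact measurePreserving_leapfrog (measurable_addDrift hτ) (measurePreserving_addDrift _) hg

/-- … and so does every trajectory of `N` steps. -/
theorem measurePreserving_lfMode_iterate (δ w2 : ℝ) (N : ℕ) :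
    MeasurePreserving ((lfMode δ w2)^[N]) ((volume : Measure ℝ).prod volume)
      ((volume : Measure ℝ).prod volume) :=
  (measurePreserving_lfMode δ w2).iterate N

end Liouville

/-! ## §2 The shadow Gaussian -/

section Shadow

/-- **The shadow variance** `v = 1/Ω² − δ²/4`: the mode variance of the Gaussian left invariant by
UNADJUSTED leapfrog (the exact value is `1/Ω²`). -/
noncomputable def shadowVariance (δ w2 : ℝ) : ℝ := 1 / w2 - δ ^ 2 / 4

/-- `v = (1 − δ²Ω²/4)/Ω²`. -/
theorem shadowVariance_eq {δ w2 : ℝ} (hw : w2 ≠ 0) :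
    shadowVariance δ w2 = (1 - δ ^ 2 * w2 / 4) / w2 := by
  unfold shadowVariance
  field_simp

/-- In the stable regime `δ²Ω² < 4` the shadow variance is positive. -/
theorem shadowVariance_pos {δ w2 : ℝ} (hw : 0 < w2) (hst : δ ^ 2 * w2 < 4) :
    0 < shadowVariance δ w2 := by
  rw [shadowVariance_eq hw.ne']
  exact div_pos (by nlinarith) hw

/-- **The bias is one-signed**: `v < 1/Ω²` — the unadjusted chain UNDER-estimates every mode
variance, by exactly `δ²/4`, whenever `δ ≠ 0`. -/
theorem shadowVariance_lt {δ : ℝ} (w2 : ℝ) (hδ : δ ≠ 0) : shadowVariance δ w2 < 1 / w2 := by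
  unfold shadowVariance
  have : 0 < δ ^ 2 := by positivity
  linarith

/-- The exact mode variance minus the shadow one is `δ²/4`, uniformly in `Ω²`. -/
theorem exactVariance_sub_shadowVariance (δ w2 : ℝ) :
    1 / w2 - shadowVariance δ w2 = δ ^ 2 / 4 := by
  unfold shadowVariance
  ring

/-- `O² + v P²` is `Ω⁻²×` the conserved shadow form `Ω²O² + (1 − δ²Ω²/4)P²`, hence conserved by
every number of leapfrog steps. -/
theorem shadowForm_lfMode_iterate {δ w2 : ℝ} (hw : w2 ≠ 0) (z : ℝ × ℝ) (N : ℕ) :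
    ((lfMode δ w2)^[N] z).1 ^ 2 + shadowVariance δ w2 * ((lfMode δ w2)^[N] z).2 ^ 2
      = z.1 ^ 2 + shadowVariance δ w2 * z.2 ^ 2 := by
  have h := lfMode_iterate_shadow δ w2 z N
  rw [shadowVariance_eq hw]
  have e : ∀ O P : ℝ, O ^ 2 + (1 - δ ^ 2 * w2 / 4) / w2 * P ^ 2
      = (1 / w2) * (w2 * O ^ 2 + (1 - δ ^ 2 * w2 / 4) * P ^ 2) := by
    intro O P
    field_simp
  rw [e, e, h]

/-- **The shadow Gaussian weight is invariant under the trajectory**: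
`e^{−O_N²/(2v)} e^{−P_N²/2} = e^{−O²/(2v)} e^{−P²/2}` (stable regime, every `N`). -/
theorem shadowGauss_lfMode_iterate {δ w2 : ℝ} (hw : 0 < w2) (hst : δ ^ 2 * w2 < 4)
    (z : ℝ × ℝ) (N : ℕ) :
    Real.exp (-(((lfMode δ w2)^[N] z).1 ^ 2 / (2 * shadowVariance δ w2)))
        * Real.exp (-(((lfMode δ w2)^[N] z).2 ^ 2 / 2))
      = Real.exp (-(z.1 ^ 2 / (2 * shadowVariance δ w2))) * Real.exp (-(z.2 ^ 2 / 2)) := by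
  have hv : shadowVariance δ w2 ≠ 0 := (shadowVariance_pos hw hst).ne'
  have e : ∀ O P : ℝ, -(O ^ 2 / (2 * shadowVariance δ w2)) + -(P ^ 2 / 2)
      = -(1 / (2 * shadowVariance δ w2)) * (O ^ 2 + shadowVariance δ w2 * P ^ 2) := by
    intro O P
    field_simp
    ring
  rw [← Real.exp_add, ← Real.exp_add, e, e, shadowForm_lfMode_iterate hw.ne' z N]

end Shadow

/-! ## §3 Unadjusted leapfrog leaves `N(0, 1/Ω² − δ²/4)` invariant -/

section Unadjusted

/-- Substitution along a measure-preserving self-map, for measurable real integrands. -/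
theorem integral_comp_of_measurePreserving {X : Type*} [MeasurableSpace X] {μ : Measure X}
    {M : X → X} (hM : MeasurePreserving M μ μ) {g : X → ℝ} (hg : Measurable g) :
    ∫ x, g (M x) ∂μ = ∫ x, g x ∂μ := by
  rw [← integral_map_of_stronglyMeasurable hM.measurable hg.stronglyMeasurable, hM.map_eq]

/-- **ONE UPDATE OF UNADJUSTED HMC, seen by a mode**: refresh `P ∼ N(0,1)`, run `N` leapfrog
steps, KEEP the end point (no accept/reject):
`(U f)(O) = (∫ f((M^N(O,P)).1) e^{−P²/2} dP) / ∫ e^{−P²/2} dP`. -/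
noncomputable def unadjLeapfrogOp (δ w2 : ℝ) (N : ℕ) (f : ℝ → ℝ) (O : ℝ) : ℝ :=
  (∫ P, f (((lfMode δ w2)^[N]) (O, P)).1 * Real.exp (-(P ^ 2 / 2)))
    / ∫ P, Real.exp (-(P ^ 2 / 2))

/-- The momentum weight `e^{−P²/2}` is integrable. -/
theorem integrable_exp_neg_sq_half : Integrable fun P : ℝ => Real.exp (-(P ^ 2 / 2)) := by
  have h := integrable_exp_neg_mul_sq (by norm_num : (0 : ℝ) < 1 / 2)
  refine h.congr (Eventually.of_forall fun P => ?_)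
  simp only
  congr 1
  ring

/-- Its mass is positive (`= √(2π)`, a value never used). -/
theorem integral_exp_neg_sq_half_pos : 0 < ∫ P : ℝ, Real.exp (-(P ^ 2 / 2)) :=
  integral_exp_pos integrable_exp_neg_sq_half

/-- **UNADJUSTED LEAPFROG IS AN EXACT SAMPLER OF THE WRONG GAUSSIAN.**  In the stable regime
`δ²Ω² < 4`, for every trajectory length `N` and every measurable `f` with `f e^{−O²/(2v)}`
integrable, `v = 1/Ω² − δ²/4`:
`∫ (U f)(O) e^{−O²/(2v)} dO = ∫ f(O) e^{−O²/(2v)} dO` — the law `N(0, 1/Ω² − δ²/4)` is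
invariant under the update without the Metropolis test (with the test, `N(0, 1/Ω²)` is). -/
theorem unadjusted_leapfrog_invariant {δ w2 : ℝ} (hw : 0 < w2) (hst : δ ^ 2 * w2 < 4) (N : ℕ)
    {f : ℝ → ℝ} (hfm : Measurable f)
    (hfi : Integrable (fun O => f O * Real.exp (-(O ^ 2 / (2 * shadowVariance δ w2))))) :
    ∫ O, unadjLeapfrogOp δ w2 N f O * Real.exp (-(O ^ 2 / (2 * shadowVariance δ w2)))
      = ∫ O, f O * Real.exp (-(O ^ 2 / (2 * shadowVariance δ w2))) := by
  set M : ℝ × ℝ → ℝ × ℝ := (lfMode δ w2)^[N] with hM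
  set ρ : ℝ → ℝ := fun O => Real.exp (-(O ^ 2 / (2 * shadowVariance δ w2))) with hρ
  set γ : ℝ → ℝ := fun P => Real.exp (-(P ^ 2 / 2)) with hγ
  have hMm : Measurable M := (measurable_lfMode δ w2).iterate N
  have hMμ : MeasurePreserving M ((volume : Measure ℝ).prod volume)
      ((volume : Measure ℝ).prod volume) := measurePreserving_lfMode_iterate δ w2 N
  have hρm : Measurable ρ := by simp only [hρ]; fun_prop
  have hγm : Measurable γ := by simp only [hγ]; fun_prop
  have hγi : Integrable γ := integrable_exp_neg_sq_half
  have hZ : 0 < ∫ P, γ P := integral_exp_neg_sq_half_pos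
  -- the shadow weight `ρ ⊗ γ` is invariant under the trajectory
  have hW : ∀ z : ℝ × ℝ, ρ (M z).1 * γ (M z).2 = ρ z.1 * γ z.2 :=
    fun z => shadowGauss_lfMode_iterate hw hst z N
  -- integrability on phase space
  have hGi : Integrable (fun z : ℝ × ℝ => f z.1 * ρ z.1 * γ z.2)
      ((volume : Measure ℝ).prod volume) := hfi.mul_prod hγi
  have hGm : Measurable fun z : ℝ × ℝ => f z.1 * ρ z.1 * γ z.2 :=
    ((hfm.comp measurable_fst).mul (hρm.comp measurable_fst)).mul (hγm.comp measurable_snd)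
  have hpt : ∀ z : ℝ × ℝ, f (M z).1 * ρ z.1 * γ z.2
      = (fun y : ℝ × ℝ => f y.1 * ρ y.1 * γ y.2) (M z) := by
    intro z
    simp only
    rw [mul_assoc, ← hW z, ← mul_assoc]
  have hGMi : Integrable (fun z : ℝ × ℝ => f (M z).1 * ρ z.1 * γ z.2)
      ((volume : Measure ℝ).prod volume) := by
    have h := (hMμ.integrable_comp hGi.aestronglyMeasurable).mpr hGi
    refine h.congr (Eventually.of_forall fun z => ?_)
    show (fun y : ℝ × ℝ => f y.1 * ρ y.1 * γ y.2) (M z) = f (M z).1 * ρ z.1 * γ z.2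
    exact (hpt z).symm
  -- Fubini: `∫_O (∫_P f γ) ρ = ∫∫ f∘fst∘M · ρ ⊗ γ`
  have hfub : ∫ O, (∫ P, f (M (O, P)).1 * γ P) * ρ O
      = ∫ z, f (M z).1 * ρ z.1 * γ z.2 ∂((volume : Measure ℝ).prod volume) := by
    rw [integral_prod _ hGMi]
    refine integral_congr_ae (Eventually.of_forall fun O => ?_)
    dsimp only
    rw [← integral_mul_const]
    refine integral_congr_ae (Eventually.of_forall fun P => ?_)
    dsimp only
    ring
  -- substitution along the measure-preserving trajectory
  have hsub : ∫ z, f (M z).1 * ρ z.1 * γ z.2 ∂((volume : Measure ℝ).prod volume)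
      = ∫ z, f z.1 * ρ z.1 * γ z.2 ∂((volume : Measure ℝ).prod volume) := by
    simp_rw [hpt]
    exact integral_comp_of_measurePreserving hMμ hGm
  have hop : ∀ O, unadjLeapfrogOp δ w2 N f O = (∫ P, f (M (O, P)).1 * γ P) / ∫ P, γ P :=
    fun O => rfl
  calc ∫ O, unadjLeapfrogOp δ w2 N f O * ρ O
      = ∫ O, ((∫ P, f (M (O, P)).1 * γ P) * ρ O) / ∫ P, γ P := by
        refine integral_congr_ae (Eventually.of_forall fun O => ?_)
        dsimp only
        rw [hop]
        ring
    _ = (∫ z, f z.1 * ρ z.1 * γ z.2 ∂((volume : Measure ℝ).prod volume)) / ∫ P, γ P := by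
        rw [integral_div, hfub, hsub]
    _ = ((∫ O, f O * ρ O) * ∫ P, γ P) / ∫ P, γ P := by
        rw [← integral_prod_mul]
    _ = ∫ O, f O * ρ O := mul_div_cancel_right₀ _ hZ.ne'

/-- **Bounded observables**: the same for every bounded measurable `f` (the weight is integrable). -/
theorem unadjusted_leapfrog_invariant_of_bounded {δ w2 : ℝ} (hw : 0 < w2) (hst : δ ^ 2 * w2 < 4)
    (N : ℕ) {f : ℝ → ℝ} (hfm : Measurable f) {B : ℝ} (hfb : ∀ O, |f O| ≤ B) :
    ∫ O, unadjLeapfrogOp δ w2 N f O * Real.exp (-(O ^ 2 / (2 * shadowVariance δ w2)))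
      = ∫ O, f O * Real.exp (-(O ^ 2 / (2 * shadowVariance δ w2))) := by
  have hv := shadowVariance_pos hw hst
  have hρi : Integrable fun O : ℝ => Real.exp (-(O ^ 2 / (2 * shadowVariance δ w2))) := by
    have h := integrable_exp_neg_mul_sq (b := 1 / (2 * shadowVariance δ w2)) (by positivity)
    refine h.congr (Eventually.of_forall fun O => ?_)
    simp only
    congr 1
    field_simp
  refine unadjusted_leapfrog_invariant hw hst N hfm ?_
  have hρm : Measurable fun O : ℝ => Real.exp (-(O ^ 2 / (2 * shadowVariance δ w2))) := by
    fun_prop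
  refine Integrable.mono' (hρi.const_mul B) (hfm.mul hρm).aestronglyMeasurable
    (Eventually.of_forall fun O => ?_)
  rw [Real.norm_eq_abs, abs_mul, abs_of_pos (Real.exp_pos _)]
  exact mul_le_mul_of_nonneg_right (hfb O) (Real.exp_pos _).le

end Unadjusted

/-! ## §4 Rotation form: the AR(1) variance map of the update -/

section Rotation

/-- `sin²θ = δ²Ω²(1 − δ²Ω²/4)` for `θ = arccos(1 − δ²Ω²/2)` in the stable regime. -/
theorem sin_sq_arccos_leapfrog {δ w2 : ℝ} (hw : 0 < w2) (hst : δ ^ 2 * w2 < 4) :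
    Real.sin (Real.arccos (1 - δ ^ 2 * w2 / 2)) ^ 2 = δ ^ 2 * w2 * (1 - δ ^ 2 * w2 / 4) := by
  have hδ2 : 0 ≤ δ ^ 2 := sq_nonneg δ
  have ha1 : -1 ≤ 1 - δ ^ 2 * w2 / 2 := by nlinarith
  have ha2 : 1 - δ ^ 2 * w2 / 2 ≤ 1 := by nlinarith
  have hcos : Real.cos (Real.arccos (1 - δ ^ 2 * w2 / 2)) = 1 - δ ^ 2 * w2 / 2 :=
    Real.cos_arccos ha1 ha2
  have := Real.sin_sq_add_cos_sq (Real.arccos (1 - δ ^ 2 * w2 / 2))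
  rw [hcos] at this
  nlinarith

/-- **`β² = v`**: the momentum coefficient of the rotation form
(`lfMode_iterate_rotation`: `O_N = cos(Nθ) O + β sin(Nθ) P`) squares to the shadow variance. -/
theorem rotation_beta_sq {δ w2 : ℝ} (hδ : δ ≠ 0) (hw : 0 < w2) (hst : δ ^ 2 * w2 < 4) :
    (δ * (1 - δ ^ 2 * w2 / 4) / Real.sin (Real.arccos (1 - δ ^ 2 * w2 / 2))) ^ 2
      = shadowVariance δ w2 := by
  have hq : 0 < 1 - δ ^ 2 * w2 / 4 := by nlinarith
  have hδ2 : 0 < δ ^ 2 := by positivity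
  rw [div_pow, sin_sq_arccos_leapfrog hw hst, shadowVariance_eq hw.ne']
  field_simp

/-- **The shadow variance is the fixed point of the update's variance map**: for
`O' = cos(Nθ) O + β sin(Nθ) P` with `P ∼ N(0,1)` independent of `O`,
`Var O' = cos²(Nθ) Var O + β² sin²(Nθ)`, and `cos²(Nθ) v + β² sin²(Nθ) = v`. -/
theorem shadowVariance_fixedPoint {δ w2 : ℝ} (hδ : δ ≠ 0) (hw : 0 < w2) (hst : δ ^ 2 * w2 < 4)
    (N : ℕ) :
    Real.cos (N * Real.arccos (1 - δ ^ 2 * w2 / 2)) ^ 2 * shadowVariance δ w2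
        + (δ * (1 - δ ^ 2 * w2 / 4) / Real.sin (Real.arccos (1 - δ ^ 2 * w2 / 2))
            * Real.sin (N * Real.arccos (1 - δ ^ 2 * w2 / 2))) ^ 2
      = shadowVariance δ w2 := by
  rw [mul_pow, rotation_beta_sq hδ hw hst]
  have := Real.sin_sq_add_cos_sq (N * Real.arccos (1 - δ ^ 2 * w2 / 2))
  linear_combination shadowVariance δ w2 * this

/-- **The exact variance is NOT a fixed point**: one unadjusted update started from the exact law
`N(0, 1/Ω²)` lowers the mode variance by `sin²(Nθ)·δ²/4`. -/
theorem exactVariance_step {δ w2 : ℝ} (hδ : δ ≠ 0) (hw : 0 < w2) (hst : δ ^ 2 * w2 < 4)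
    (N : ℕ) :
    Real.cos (N * Real.arccos (1 - δ ^ 2 * w2 / 2)) ^ 2 * (1 / w2)
        + (δ * (1 - δ ^ 2 * w2 / 4) / Real.sin (Real.arccos (1 - δ ^ 2 * w2 / 2))
            * Real.sin (N * Real.arccos (1 - δ ^ 2 * w2 / 2))) ^ 2
      = 1 / w2 - Real.sin (N * Real.arccos (1 - δ ^ 2 * w2 / 2)) ^ 2 * (δ ^ 2 / 4) := by
  rw [mul_pow, rotation_beta_sq hδ hw hst]
  have := Real.sin_sq_add_cos_sq (N * Real.arccos (1 - δ ^ 2 * w2 / 2))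
  unfold shadowVariance
  linear_combination (1 / w2) * this

end Rotation

end Summit.Ventures.LatticeQCDFlow.Scoring
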